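import Mathlib.LinearAlgebra.Matrix.Charpoly.Coeff
import Mathlib.LinearAlgebra.Matrix.NonsingularInverse
import Mathlib.FieldTheory.Separable
import Mathlib.FieldTheory.Perfect
import Mathlib.FieldTheory.KummerPolynomial
import Mathlib.Algebra.Polynomial.SpecificDegree
import Mathlib.RingTheory.PrincipalIdealDomain
import Mathlib.Tactic.ComputeDegree
import HarnessLib

/-!
# The cubic torus of `U(Φ₃)` — Cartan subgroups of type (3) of the quasi-split unitary group in three variables,
# in the regular representation of the pure cubic algebra `E[x]/(x³ − a)` ([Rogawski1990] §3.6)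

Topic `NumberTheory/Rogawski1990`; namespace `Literature.NumberTheory.Rogawski1990.TypeThreeTorus`.  THEOREMS ONLY (no
definition, no instance, no notation, no named fact, no `sorry`); generic algebra over a commutative ring `R` (§1–§2) and over a
field `K` (§3); Mathlib-only imports.  Written for the cell `pub/hodgecm-mathlib` (crux H413, line LH6 «StCharTSPaydown», the
`T` of the (S-𝔇) package binder `∃ 𝔇 d T par` and its (T3) clause «a Cartan subgroup of type (3): its regular elements are
unmatched»); unconditional matrix algebra, kernel lane `--supports stmt-HodgeConjecture-24833`.

THE MATHEMATICS.  `E/F` a quadratic extension with involution `σ`, `Φ₃ = antidiag(1,1,1)`, `a ∈ F^×`.  By [Rogawski1990, §3.6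
p. 31] the Cartan subgroups of `U(3)(F)` of TYPE (3) are `T ≅ ker(N_{EK/K} : (EK)^× → K^×)` for `K/F` a CUBIC field extension.
Take `K = F(a^{1/3})`, `Y := EK = E[x]/(x³ − a)` and let `Y` act on itself in the basis `(1, x, x²)`: `x ↦ C := !![0,0,a; 1,0,0; 0,1,0]`
(the companion matrix: `C e₀ = e₁`, `C e₁ = e₂`, `C e₂ = a e₀`, `C³ = a`), `p + qx + rx² ↦ M(p,q,r) := p·1 + q·C + r·C² =
!![p, a r, a q; q, p, a r; r, q, p]`.
* §1 `M(p,q,r)` is a commutative algebra closed under products (`cubicMat_mul`), it is EXACTLY the commutant of the cyclic matrix `C`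
  (`commute_companion_iff`), `det M(p,q,r) = p³ + a q³ + a² r³ − 3a·pqr` (the cubic norm form), and — the point — `M(p,q,r)ᵀ =
  Φ₃ · M(p,q,r) · Φ₃` (`transpose_cubicMat`): the `σ`-hermitian form `h(u, z) = Tr_{Y/E}(x · u · z̄)` has Gram matrix `3a · Φ₃`
  in the basis `(1, x, x²)` ON THE NOSE, so no classification of hermitian forms is needed to seat the torus in `U(Φ₃)`.
* §2 hence, for `σ : R →+* R` with `σ a = a`: `(σM)ᵀ Φ₃ M′ = Φ₃ · (M(σp,σq,σr) · M′)` and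
  `M(p,q,r) ∈ U(σ, Φ₃) ⟺ M(σp,σq,σr) · M(p,q,r) = 1` (`form_cubicMat_eq_iff`): the norm-one elements of `Y` over `K`.
* §3 over a FIELD `K` with `x³ − a` IRREDUCIBLE (`a` not a cube — Mathlib `X_pow_sub_C_irreducible_of_prime`): every non-zero
  `M(p,q,r)` is invertible (`isUnit_cubicMat`: Bezout against the irreducible cubic, evaluated at `C`); consequently a root `λ ∈ K`
  of `charpoly M(p,q,r)` forces `M = λ·1` (`eq_of_isRoot_charpoly_cubicMat`), so a REGULAR (separable characteristic polynomial)
  element of the torus has NO eigenvalue in `K` — it is «unmatched», not stably conjugate to any element of `H = U(2) × U(1)`, whose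
  elements all have an eigenvalue in `E¹` (`not_isRoot_charpoly_of_separable`); and `charpoly M(p,q,r)` is separable iff
  `(q, r) ≠ (0, 0)` when `K` is perfect (`separable_charpoly_cubicMat_iff`).
The sequel `TypeThreeCubicTorusNonsplit` instantiates this at a non-split finite place of a CM field (`a = ϖ·σϖ`, order 2, not a cube).

## References
* [Rogawski1990] J. D. Rogawski, *Automorphic Representations of Unitary Groups in Three Variables*, Ann. of Math. Stud. 123 (1990),
  §3.6 p. 31 (Cartan subgroups of types (0)–(3)), §3.4–3.5 pp. 26–29, §12.5 p. 184, Lemma 12.7.2 (proof) p. 194 («let `T` be a Cartan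
  subgroup of type (3)»).
* [PlatonovRapinchuk1994] V. Platonov, A. Rapinchuk, *Algebraic Groups and Number Theory* (1994), §2.3 (unitary groups), §6.4 (tori).
-/

set_option autoImplicit false

namespace Literature.NumberTheory.Rogawski1990.TypeThreeTorus

open Polynomial Matrix

/-! ## §1 The regular representation of `R[x]/(x³ − a)` on the basis `(1, x, x²)` -/

section CommRing

variable {R : Type*} [CommRing R]

/-- `C² = !![0,a,0; 0,0,a; 1,0,0]` for the companion matrix `C = !![0,0,a; 1,0,0; 0,1,0]` of `x³ − a` (`C²e₀ = e₂`, `C²e₁ = a e₀`,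
`C²e₂ = a e₁`). [cite: Rogawski1990, §3.6 p. 31] -/
theorem companion_mul_companion (a : R) :
    !![(0 : R), 0, a; 1, 0, 0; 0, 1, 0] * !![(0 : R), 0, a; 1, 0, 0; 0, 1, 0] = !![(0 : R), a, 0; 0, 0, a; 1, 0, 0] := by
  ext i j
  fin_cases i <;> fin_cases j <;> simp [Matrix.mul_apply, Fin.sum_univ_three]

/-- Cayley–Hamilton for the companion matrix of the pure cubic: `C³ = a·1`. [cite: Rogawski1990, §3.6 p. 31] -/
theorem companion_pow_three (a : R) :
    !![(0 : R), 0, a; 1, 0, 0; 0, 1, 0] ^ 3 = a • (1 : Matrix (Fin 3) (Fin 3) R) := by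
  rw [pow_succ, pow_two, companion_mul_companion]
  ext i j
  fin_cases i <;> fin_cases j <;> simp [Matrix.mul_apply, Fin.sum_univ_three]

/-- `det C = a`. [cite: Rogawski1990, §3.6 p. 31] -/
theorem det_companion (a : R) : (!![(0 : R), 0, a; 1, 0, 0; 0, 1, 0]).det = a := by
  rw [det_fin_three]; simp

/-- The element `p + q x + r x²` of `R[x]/(x³ − a)` acts on the basis `(1, x, x²)` by `M(p,q,r) = p·1 + q·C + r·C² =
!![p, a r, a q; q, p, a r; r, q, p]`. [cite: Rogawski1990, §3.6 p. 31] -/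
theorem cubicMat_eq_smul_add (a p q r : R) :
    !![p, a * r, a * q; q, p, a * r; r, q, p] =
      p • (1 : Matrix (Fin 3) (Fin 3) R) + q • !![(0 : R), 0, a; 1, 0, 0; 0, 1, 0] + r • !![(0 : R), 0, a; 1, 0, 0; 0, 1, 0] ^ 2 := by
  rw [pow_two, companion_mul_companion, one_fin_three]
  ext i j
  fin_cases i <;> fin_cases j <;> simp [mul_comm]

/-- The multiplication table of `R[x]/(x³ − a)`: `M(p,q,r) · M(p′,q′,r′) = M(pp′ + a(qr′ + rq′), pq′ + qp′ + a rr′, pr′ + qq′ + rp′)`.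
[cite: Rogawski1990, §3.6 p. 31] -/
theorem cubicMat_mul (a p q r p' q' r' : R) :
    !![p, a * r, a * q; q, p, a * r; r, q, p] * !![p', a * r', a * q'; q', p', a * r'; r', q', p'] =
      !![p * p' + a * (q * r' + r * q'), a * (p * r' + q * q' + r * p'), a * (p * q' + q * p' + a * (r * r'));
        p * q' + q * p' + a * (r * r'), p * p' + a * (q * r' + r * q'), a * (p * r' + q * q' + r * p');
        p * r' + q * q' + r * p', p * q' + q * p' + a * (r * r'), p * p' + a * (q * r' + r * q')] := by
  ext i j
  fin_cases i <;> fin_cases j <;> simp [Matrix.mul_apply, Fin.sum_univ_three] <;> ring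

/-- `R[x]/(x³ − a)` is commutative: `M(p,q,r) · M(p′,q′,r′) = M(p′,q′,r′) · M(p,q,r)`. [cite: Rogawski1990, §3.6 p. 31] -/
theorem cubicMat_comm (a p q r p' q' r' : R) :
    !![p, a * r, a * q; q, p, a * r; r, q, p] * !![p', a * r', a * q'; q', p', a * r'; r', q', p'] =
      !![p', a * r', a * q'; q', p', a * r'; r', q', p'] * !![p, a * r, a * q; q, p, a * r; r, q, p] := by
  rw [cubicMat_mul, cubicMat_mul]
  ext i j
  fin_cases i <;> fin_cases j <;> simp <;> ring

/-- Every `M(p,q,r)` commutes with the companion matrix `C = M(0,1,0)`. [cite: Rogawski1990, §3.6 p. 31] -/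
theorem cubicMat_mul_companion (a p q r : R) :
    !![p, a * r, a * q; q, p, a * r; r, q, p] * !![(0 : R), 0, a; 1, 0, 0; 0, 1, 0] =
      !![(0 : R), 0, a; 1, 0, 0; 0, 1, 0] * !![p, a * r, a * q; q, p, a * r; r, q, p] := by
  ext i j
  fin_cases i <;> fin_cases j <;> simp [Matrix.mul_apply, Fin.sum_univ_three] <;> ring

/-- **The commutant of the cyclic matrix `C` is `R[C]`**: `A · C = C · A` iff `A = M(A₀₀, A₁₀, A₂₀)` (a matrix commuting with `C` is
determined by its first column, since `e₁ = Ce₀`, `e₂ = C²e₀`).  So the torus below is the full centraliser of `C` in `U(Φ₃)`.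
[cite: Rogawski1990, §3.6 p. 31] -/
theorem commute_companion_iff (a : R) (A : Matrix (Fin 3) (Fin 3) R) :
    A * !![(0 : R), 0, a; 1, 0, 0; 0, 1, 0] = !![(0 : R), 0, a; 1, 0, 0; 0, 1, 0] * A ↔
      A = !![A 0 0, a * A 2 0, a * A 1 0; A 1 0, A 0 0, a * A 2 0; A 2 0, A 1 0, A 0 0] := by
  constructor
  · intro h
    have hA : A = !![A 0 0, A 0 1, A 0 2; A 1 0, A 1 1, A 1 2; A 2 0, A 2 1, A 2 2] := by
      ext i j; fin_cases i <;> fin_cases j <;> rfl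
    rw [hA, mul_fin_three, mul_fin_three] at h
    simp only [mul_zero, mul_one, zero_mul, one_mul, add_zero, zero_add] at h
    have h01 : A 0 1 = a * A 2 0 := by have := congrFun (congrFun h 0) 0; simpa using this
    have h11 : A 1 1 = A 0 0 := by have := congrFun (congrFun h 1) 0; simpa using this
    have h21 : A 2 1 = A 1 0 := by have := congrFun (congrFun h 2) 0; simpa using this
    have h02 : A 0 2 = a * A 1 0 := by
      have := congrFun (congrFun h 0) 1; simp at this; rw [this, h21]
    have h12 : A 1 2 = a * A 2 0 := by
      have := congrFun (congrFun h 1) 1; simp at this; rw [this, h01]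
    have h22 : A 2 2 = A 0 0 := by
      have := congrFun (congrFun h 2) 1; simp at this; rw [this, h11]
    rw [hA]
    ext i j; fin_cases i <;> fin_cases j <;> simp [h01, h11, h21, h02, h12, h22]
  · intro h
    rw [h]
    exact cubicMat_mul_companion a (A 0 0) (A 1 0) (A 2 0)

/-- The cubic norm form: `det M(p,q,r) = p³ + a q³ + a² r³ − 3a·pqr` (`= N_{Y/R}(p + qx + rx²)`). [cite: Rogawski1990, §3.6 p. 31] -/
theorem det_cubicMat (a p q r : R) :
    (!![p, a * r, a * q; q, p, a * r; r, q, p]).det = p ^ 3 + a * q ^ 3 + a ^ 2 * r ^ 3 - 3 * a * p * q * r := by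
  rw [det_fin_three]; simp; ring

/-- `Φ₃² = 1` for the split form `Φ₃ = antidiag(1,1,1)` of [Rogawski1990] §1.9. [cite: Rogawski1990, §1.9 p. 8] -/
theorem antidiag_mul_antidiag :
    !![(0 : R), 0, 1; 0, 1, 0; 1, 0, 0] * !![(0 : R), 0, 1; 0, 1, 0; 1, 0, 0] = 1 := by
  rw [mul_fin_three, one_fin_three]; simp

/-- The house spelling of the split form: `Matrix.of (fun i j : Fin 3 => if i.val + j.val + 1 = 3 then 1 else 0) = !![0,0,1; 0,1,0; 1,0,0]`.
[cite: Rogawski1990, §1.9 p. 8] -/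
theorem antidiag_of_eq : (Matrix.of fun i j : Fin 3 => if i.val + j.val + 1 = 3 then (1 : R) else 0) = !![(0 : R), 0, 1; 0, 1, 0; 1, 0, 0] := by
  ext i j; fin_cases i <;> fin_cases j <;> rfl

/-- **KEY IDENTITY `M(p,q,r)ᵀ = Φ₃ · M(p,q,r) · Φ₃`** — the matrices `M(p,q,r)` are `Φ₃`-symmetric (persymmetric): the hermitian form
`Tr_{Y/E}(x · u · z̄)` on `Y = E[x]/(x³ − a)` has Gram matrix `3a · Φ₃` in the basis `(1, x, x²)` (`Tr x^k = 0` unless `3 ∣ k`), and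
multiplication by `y` is adjoint to multiplication by `ȳ`. [cite: Rogawski1990, §3.6 p. 31] -/
theorem transpose_cubicMat (a p q r : R) :
    (!![p, a * r, a * q; q, p, a * r; r, q, p])ᵀ =
      !![(0 : R), 0, 1; 0, 1, 0; 1, 0, 0] * !![p, a * r, a * q; q, p, a * r; r, q, p] * !![(0 : R), 0, 1; 0, 1, 0; 1, 0, 0] := by
  rw [mul_fin_three, mul_fin_three]
  ext i j; fin_cases i <;> fin_cases j <;> simp

/-- `M(p,q,r)` under an entrywise ring map: `σ M(p,q,r) = M(σa; σp, σq, σr)` (the conjugation of `EK = E[x]/(x³ − a)` over `K`). [cite: Rogawski1990, §3.6 p. 31] -/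
theorem map_cubicMat {S : Type*} [CommRing S] (σ : R →+* S) (a p q r : R) :
    (!![p, a * r, a * q; q, p, a * r; r, q, p]).map σ = !![σ p, σ a * σ r, σ a * σ q; σ q, σ p, σ a * σ r; σ r, σ q, σ p] := by
  ext i j; fin_cases i <;> fin_cases j <;> simp

/-! ## §2 Membership in `U(σ, Φ₃) = {g | (σg)ᵀ Φ₃ g = Φ₃}` -/

/-- For `σ a = a`: `(σ M(p,q,r))ᵀ · Φ₃ · M′ = Φ₃ · (M(σp,σq,σr) · M′)` — the hermitian pairing of the regular representation is
multiplication in `Y` followed by `Φ₃`. [cite: Rogawski1990, §3.6 p. 31] -/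
theorem map_transpose_mul_antidiag_mul (σ : R →+* R) {a : R} (ha : σ a = a) (p q r : R) (M' : Matrix (Fin 3) (Fin 3) R) :
    ((!![p, a * r, a * q; q, p, a * r; r, q, p]).map σ)ᵀ * !![(0 : R), 0, 1; 0, 1, 0; 1, 0, 0] * M' =
      !![(0 : R), 0, 1; 0, 1, 0; 1, 0, 0] * (!![σ p, a * σ r, a * σ q; σ q, σ p, a * σ r; σ r, σ q, σ p] * M') := by
  rw [map_cubicMat, ha, transpose_cubicMat, Matrix.mul_assoc _ _ (!![(0 : R), 0, 1; 0, 1, 0; 1, 0, 0]), antidiag_mul_antidiag,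
    Matrix.mul_one, Matrix.mul_assoc]

/-- **`M(p,q,r) ∈ U(σ, Φ₃) ⟺ M(σp,σq,σr) · M(p,q,r) = 1`** (for `σ a = a`): the cubic torus is the group of norm-one elements of
`Y = E[x]/(x³ − a)` over its `σ`-fixed subalgebra `K = F[x]/(x³ − a)`, `T ≅ ker N_{EK/K}` — type (3) of [Rogawski1990, §3.6] when
`K` is a field. [cite: Rogawski1990, §3.6 p. 31] -/
theorem form_cubicMat_eq_iff (σ : R →+* R) {a : R} (ha : σ a = a) (p q r : R) :
    ((!![p, a * r, a * q; q, p, a * r; r, q, p]).map σ)ᵀ * !![(0 : R), 0, 1; 0, 1, 0; 1, 0, 0] * !![p, a * r, a * q; q, p, a * r; r, q, p] =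
        !![(0 : R), 0, 1; 0, 1, 0; 1, 0, 0] ↔
      !![σ p, a * σ r, a * σ q; σ q, σ p, a * σ r; σ r, σ q, σ p] * !![p, a * r, a * q; q, p, a * r; r, q, p] = 1 := by
  rw [map_transpose_mul_antidiag_mul σ ha]
  constructor
  · intro h
    calc !![σ p, a * σ r, a * σ q; σ q, σ p, a * σ r; σ r, σ q, σ p] * !![p, a * r, a * q; q, p, a * r; r, q, p]
        = !![(0 : R), 0, 1; 0, 1, 0; 1, 0, 0] * (!![(0 : R), 0, 1; 0, 1, 0; 1, 0, 0] *
            (!![σ p, a * σ r, a * σ q; σ q, σ p, a * σ r; σ r, σ q, σ p] * !![p, a * r, a * q; q, p, a * r; r, q, p])) := by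
          rw [← Matrix.mul_assoc, antidiag_mul_antidiag, Matrix.one_mul]
      _ = 1 := by rw [h, antidiag_mul_antidiag]
  · intro h
    rw [h, Matrix.mul_one]

/-- A unitary element commuting with `C` (i.e. an element of the cubic torus `U(σ,Φ₃) ⊓ Z(C)`) has the shape `M(p,q,r)` with
`M(σp,σq,σr) · M(p,q,r) = 1`. [cite: Rogawski1990, §3.6 p. 31] -/
theorem exists_eq_cubicMat_of_commute_of_form (σ : R →+* R) {a : R} (ha : σ a = a) (g : Matrix (Fin 3) (Fin 3) R)
    (hc : g * !![(0 : R), 0, a; 1, 0, 0; 0, 1, 0] = !![(0 : R), 0, a; 1, 0, 0; 0, 1, 0] * g)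
    (hu : (g.map σ)ᵀ * !![(0 : R), 0, 1; 0, 1, 0; 1, 0, 0] * g = !![(0 : R), 0, 1; 0, 1, 0; 1, 0, 0]) :
    ∃ p q r : R, g = !![p, a * r, a * q; q, p, a * r; r, q, p] ∧
      !![σ p, a * σ r, a * σ q; σ q, σ p, a * σ r; σ r, σ q, σ p] * !![p, a * r, a * q; q, p, a * r; r, q, p] = 1 := by
  have hg := (commute_companion_iff a g).mp hc
  refine ⟨g 0 0, g 1 0, g 2 0, hg, ?_⟩
  rw [← form_cubicMat_eq_iff σ ha, ← hg]
  exact hu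

end CommRing

/-! ## §3 Over a field with `x³ − a` irreducible: invertibility, eigenvalues, regularity -/

section Field

variable {K : Type*} [Field K]

/-- `x³ − a` is irreducible over a field as soon as `a` is not a cube (Mathlib `X_pow_sub_C_irreducible_of_prime` at `p = 3`).
[cite: Rogawski1990, §3.6 p. 31] -/
theorem irreducible_X_pow_three_sub_C {a : K} (ha : ∀ b : K, b ^ 3 ≠ a) : Irreducible (X ^ 3 - C a : K[X]) :=
  X_pow_sub_C_irreducible_of_prime Nat.prime_three ha

/-- `aeval C (p + qX + rX²) = M(p,q,r)` for the companion matrix `C`. [folklore] -/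
private theorem aeval_companion_eq_cubicMat (a p q r : K) :
    aeval (!![(0 : K), 0, a; 1, 0, 0; 0, 1, 0]) (C p + C q * X + C r * X ^ 2) = !![p, a * r, a * q; q, p, a * r; r, q, p] := by
  rw [cubicMat_eq_smul_add, map_add, map_add, map_mul, map_mul, aeval_C, aeval_C, aeval_C, aeval_X, aeval_X_pow,
    Algebra.algebraMap_eq_smul_one, Algebra.algebraMap_eq_smul_one, Algebra.algebraMap_eq_smul_one, smul_one_mul, smul_one_mul]

/-- `aeval C (X³ − a) = 0` (Cayley–Hamilton for the companion matrix). [folklore] -/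
private theorem aeval_companion_X_pow_three_sub_C (a : K) :
    aeval (!![(0 : K), 0, a; 1, 0, 0; 0, 1, 0]) (X ^ 3 - C a : K[X]) = 0 := by
  rw [map_sub, aeval_X_pow, aeval_C, Algebra.algebraMap_eq_smul_one, companion_pow_three, sub_self]

/-- **`Y = K[x]/(x³ − a)` is a field: every non-zero `M(p,q,r)` is invertible** when `x³ − a` is irreducible — Bezout
`u·(X³ − a) + v·(p + qX + rX²) = 1` (the cubic is irreducible and does not divide a non-zero polynomial of degree `≤ 2`),
evaluated at `C`. [cite: Rogawski1990, §3.6 p. 31] -/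
theorem isUnit_cubicMat {a : K} (hirr : Irreducible (X ^ 3 - C a : K[X])) {p q r : K} (h : ¬ (p = 0 ∧ q = 0 ∧ r = 0)) :
    IsUnit (!![p, a * r, a * q; q, p, a * r; r, q, p]) := by
  set φ : K[X] := C p + C q * X + C r * X ^ 2 with hφ
  have hφ0 : φ ≠ 0 := by
    intro h0
    apply h
    have c0 := congrArg (fun f : K[X] => f.coeff 0) h0
    have c1 := congrArg (fun f : K[X] => f.coeff 1) h0
    have c2 := congrArg (fun f : K[X] => f.coeff 2) h0
    simp [hφ, coeff_X, coeff_C] at c0 c1 c2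
    exact ⟨c0, c1, c2⟩
  have hdegφ : φ.natDegree ≤ 2 := by rw [hφ]; compute_degree
  have hdeg3 : (X ^ 3 - C a : K[X]).natDegree = 3 := by rw [natDegree_X_pow_sub_C]
  have hndvd : ¬ (X ^ 3 - C a : K[X]) ∣ φ := by
    intro hd
    have := natDegree_le_of_dvd hd hφ0
    rw [hdeg3] at this
    omega
  have hcop : IsCoprime (X ^ 3 - C a : K[X]) φ := (hirr.coprime_iff_not_dvd).mpr hndvd
  obtain ⟨u, w, huw⟩ := hcop
  have h1 := congrArg (aeval (!![(0 : K), 0, a; 1, 0, 0; 0, 1, 0])) huw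
  rw [map_add, map_mul, map_mul, aeval_companion_X_pow_three_sub_C, mul_zero, zero_add, map_one, hφ,
    aeval_companion_eq_cubicMat] at h1
  rw [Matrix.isUnit_iff_isUnit_det]
  have h2 := congrArg Matrix.det h1
  rw [det_mul, det_one] at h2
  exact IsUnit.of_mul_eq_one_right _ h2

/-- **An eigenvalue in `K` forces a scalar**: if `λ ∈ K` is a root of `charpoly M(p,q,r)` and `x³ − a` is irreducible, then
`p = λ`, `q = 0`, `r = 0` (`λ·1 − M(p,q,r) = M(λ − p, −q, −r)` is singular, hence zero by `isUnit_cubicMat`). [cite: Rogawski1990, §3.6 p. 31] -/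
theorem eq_of_isRoot_charpoly_cubicMat {a : K} (hirr : Irreducible (X ^ 3 - C a : K[X])) {p q r μ : K}
    (hμ : (!![p, a * r, a * q; q, p, a * r; r, q, p]).charpoly.IsRoot μ) : p = μ ∧ q = 0 ∧ r = 0 := by
  rw [IsRoot.def, eval_charpoly] at hμ
  have hM : Matrix.scalar (Fin 3) μ - !![p, a * r, a * q; q, p, a * r; r, q, p] =
      !![μ - p, a * (-r), a * (-q); -q, μ - p, a * (-r); -r, -q, μ - p] := by
    rw [scalar_apply]
    ext i j; fin_cases i <;> fin_cases j <;> simp [Matrix.diagonal]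
  rw [hM] at hμ
  by_contra hne
  have hne' : ¬ (μ - p = 0 ∧ -q = 0 ∧ -r = 0) := by
    rintro ⟨h1, h2, h3⟩
    exact hne ⟨(sub_eq_zero.mp h1).symm, neg_eq_zero.mp h2, neg_eq_zero.mp h3⟩
  have hu := isUnit_cubicMat hirr hne'
  rw [Matrix.isUnit_iff_isUnit_det, hμ] at hu
  exact not_isUnit_zero hu

/-- `charpoly M(μ,0,0) = (X − μ)³` — a scalar is not regular. [folklore] -/
private theorem charpoly_cubicMat_scalar (a μ : K) :
    (!![μ, a * 0, a * 0; 0, μ, a * 0; 0, 0, μ]).charpoly = (X - C μ) ^ 3 := by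
  have h : !![μ, a * 0, a * 0; 0, μ, a * 0; 0, 0, μ] = Matrix.diagonal (fun _ : Fin 3 => μ) := by
    ext i j; fin_cases i <;> fin_cases j <;> simp [Matrix.diagonal]
  rw [h, charpoly_diagonal, Finset.prod_const, Finset.card_univ, Fintype.card_fin]

/-- `(X − μ)³` is not separable. [folklore] -/
private theorem not_separable_X_sub_C_pow_three (μ : K) : ¬ ((X - C μ) ^ 3 : K[X]).Separable := by
  intro h
  have := (Separable.of_pow (not_isUnit_X_sub_C μ) (by norm_num : (3 : ℕ) ≠ 0) h).2
  omega

/-- **(T3) «regular elements of a type-(3) torus are unmatched»**: if `x³ − a` is irreducible over `K` and `M(p,q,r)` is REGULAR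
(separable characteristic polynomial, the tree's `IsRegularElt`), then `charpoly M(p,q,r)` has NO root in `K` — in particular no
eigenvalue in `E¹ ⊂ K`, so `M(p,q,r)` is not (stably) conjugate to an element of the endoscopic `H = U(2) × U(1)`.  [Rogawski1990,
Lemma 12.7.2 (proof) p. 194: «Let `T` be a Cartan subgroup of type (3) … `Φ(γ, f^H)`-terms do not occur».]
[cite: Rogawski1990, §12.7 p. 194; §3.6 p. 31] -/
theorem not_isRoot_charpoly_of_separable {a : K} (hirr : Irreducible (X ^ 3 - C a : K[X])) {p q r : K}
    (hsep : (!![p, a * r, a * q; q, p, a * r; r, q, p]).charpoly.Separable) (μ : K) :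
    ¬ (!![p, a * r, a * q; q, p, a * r; r, q, p]).charpoly.IsRoot μ := by
  intro hμ
  obtain ⟨rfl, rfl, rfl⟩ := eq_of_isRoot_charpoly_cubicMat hirr hμ
  rw [charpoly_cubicMat_scalar] at hsep
  exact not_separable_X_sub_C_pow_three p hsep

/-- A non-regular element of the torus is a SCALAR: if `charpoly M(p,q,r)` is not separable (over a perfect field, `x³ − a`
irreducible) then `q = r = 0`.  (A cubic over a perfect field with no root is irreducible, hence separable.) [cite: Rogawski1990, §3.6 p. 31] -/
theorem eq_zero_of_not_separable_charpoly [PerfectField K] {a : K} (hirr : Irreducible (X ^ 3 - C a : K[X])) {p q r : K}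
    (hns : ¬ (!![p, a * r, a * q; q, p, a * r; r, q, p]).charpoly.Separable) : q = 0 ∧ r = 0 := by
  by_contra hqr
  apply hns
  apply PerfectField.separable_of_irreducible
  refine irreducible_of_degree_le_three_of_not_isRoot ?_ fun μ hμ => ?_
  · rw [charpoly_natDegree_eq_dim, Fintype.card_fin]; decide
  · obtain ⟨-, hq, hr⟩ := eq_of_isRoot_charpoly_cubicMat hirr hμ
    exact hqr ⟨hq, hr⟩

/-- **Regularity criterion on the cubic torus** (perfect field, `x³ − a` irreducible): `charpoly M(p,q,r)` is separable iff
`(q, r) ≠ (0, 0)`, i.e. iff `p + qx + rx² ∉ K` — the regular set of `T` is the complement of the scalars `E¹ ⊂ T`.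
[cite: Rogawski1990, §3.6 p. 31; §3.1 p. 19] -/
theorem separable_charpoly_cubicMat_iff [PerfectField K] {a : K} (hirr : Irreducible (X ^ 3 - C a : K[X])) (p q r : K) :
    (!![p, a * r, a * q; q, p, a * r; r, q, p]).charpoly.Separable ↔ ¬ (q = 0 ∧ r = 0) := by
  constructor
  · rintro hsep ⟨rfl, rfl⟩
    rw [charpoly_cubicMat_scalar] at hsep
    exact not_separable_X_sub_C_pow_three p hsep
  · intro h
    by_contra hns
    exact h (eq_zero_of_not_separable_charpoly hirr hns)

/-- **The unitary torus element attached to `u = 1 + t·x`**: for `σ t = −t` (so `ū = 1 − t x`) and `1 − a t³ ≠ 0`, the element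
`y = u/ū = (1 + t x)² (1 + t x + t² x²)⁄(1 − a t³)`… precisely `y = ((1 + a t³) + 2t·x + 2t²·x²)⁄(1 − a t³)` has norm one:
`M(σ•) · M(•) = 1` for `M = M(p,q,r)`, `p = (1 + a t³)(1 − a t³)⁻¹`, `q = 2t(1 − a t³)⁻¹`, `r = 2t²(1 − a t³)⁻¹` — the one-parameter
family of torus elements used to show that regular elements accumulate at `1`. [cite: Rogawski1990, §3.6 p. 31] -/
theorem cubicMat_curve_mul_eq_one (σ : K →+* K) {a t : K} (ha : σ a = a) (ht : σ t = -t) (hd : 1 - a * t ^ 3 ≠ 0) :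
    !![σ ((1 + a * t ^ 3) * (1 - a * t ^ 3)⁻¹), a * σ (2 * t ^ 2 * (1 - a * t ^ 3)⁻¹), a * σ (2 * t * (1 - a * t ^ 3)⁻¹);
        σ (2 * t * (1 - a * t ^ 3)⁻¹), σ ((1 + a * t ^ 3) * (1 - a * t ^ 3)⁻¹), a * σ (2 * t ^ 2 * (1 - a * t ^ 3)⁻¹);
        σ (2 * t ^ 2 * (1 - a * t ^ 3)⁻¹), σ (2 * t * (1 - a * t ^ 3)⁻¹), σ ((1 + a * t ^ 3) * (1 - a * t ^ 3)⁻¹)] *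
      !![(1 + a * t ^ 3) * (1 - a * t ^ 3)⁻¹, a * (2 * t ^ 2 * (1 - a * t ^ 3)⁻¹), a * (2 * t * (1 - a * t ^ 3)⁻¹);
        2 * t * (1 - a * t ^ 3)⁻¹, (1 + a * t ^ 3) * (1 - a * t ^ 3)⁻¹, a * (2 * t ^ 2 * (1 - a * t ^ 3)⁻¹);
        2 * t ^ 2 * (1 - a * t ^ 3)⁻¹, 2 * t * (1 - a * t ^ 3)⁻¹, (1 + a * t ^ 3) * (1 - a * t ^ 3)⁻¹] = 1 := by
  have hd' : 1 + a * t ^ 3 ≠ 0 := by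
    intro h0
    apply hd
    have : σ (1 + a * t ^ 3) = 1 - a * t ^ 3 := by rw [map_add, map_one, map_mul, map_pow, ha, ht]; ring
    rw [← this, h0, map_zero]
  have hσd : σ ((1 - a * t ^ 3)⁻¹) = (1 + a * t ^ 3)⁻¹ := by
    rw [map_inv₀, map_sub, map_one, map_mul, map_pow, ha, ht]; congr 1; ring
  have h2 : σ 2 = 2 := map_ofNat σ 2
  have eσ : !![σ ((1 + a * t ^ 3) * (1 - a * t ^ 3)⁻¹), a * σ (2 * t ^ 2 * (1 - a * t ^ 3)⁻¹), a * σ (2 * t * (1 - a * t ^ 3)⁻¹);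
        σ (2 * t * (1 - a * t ^ 3)⁻¹), σ ((1 + a * t ^ 3) * (1 - a * t ^ 3)⁻¹), a * σ (2 * t ^ 2 * (1 - a * t ^ 3)⁻¹);
        σ (2 * t ^ 2 * (1 - a * t ^ 3)⁻¹), σ (2 * t * (1 - a * t ^ 3)⁻¹), σ ((1 + a * t ^ 3) * (1 - a * t ^ 3)⁻¹)] =
      (1 + a * t ^ 3)⁻¹ • !![1 - a * t ^ 3, a * (2 * t ^ 2), a * (-(2 * t)); -(2 * t), 1 - a * t ^ 3, a * (2 * t ^ 2);
        2 * t ^ 2, -(2 * t), 1 - a * t ^ 3] := by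
    ext i j
    fin_cases i <;> fin_cases j <;> simp [map_mul, map_add, map_pow, ha, ht, hσd, h2, -map_inv₀] <;> ring
  have e : !![(1 + a * t ^ 3) * (1 - a * t ^ 3)⁻¹, a * (2 * t ^ 2 * (1 - a * t ^ 3)⁻¹), a * (2 * t * (1 - a * t ^ 3)⁻¹);
        2 * t * (1 - a * t ^ 3)⁻¹, (1 + a * t ^ 3) * (1 - a * t ^ 3)⁻¹, a * (2 * t ^ 2 * (1 - a * t ^ 3)⁻¹);
        2 * t ^ 2 * (1 - a * t ^ 3)⁻¹, 2 * t * (1 - a * t ^ 3)⁻¹, (1 + a * t ^ 3) * (1 - a * t ^ 3)⁻¹] =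
      (1 - a * t ^ 3)⁻¹ • !![1 + a * t ^ 3, a * (2 * t ^ 2), a * (2 * t); 2 * t, 1 + a * t ^ 3, a * (2 * t ^ 2);
        2 * t ^ 2, 2 * t, 1 + a * t ^ 3] := by
    ext i j
    fin_cases i <;> fin_cases j <;> simp <;> ring
  have e3 : !![1 - a * t ^ 3, a * (2 * t ^ 2), a * (-(2 * t)); -(2 * t), 1 - a * t ^ 3, a * (2 * t ^ 2);
        2 * t ^ 2, -(2 * t), 1 - a * t ^ 3] *
      !![1 + a * t ^ 3, a * (2 * t ^ 2), a * (2 * t); 2 * t, 1 + a * t ^ 3, a * (2 * t ^ 2); 2 * t ^ 2, 2 * t, 1 + a * t ^ 3] =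
      ((1 - a * t ^ 3) * (1 + a * t ^ 3)) • (1 : Matrix (Fin 3) (Fin 3) K) := by
    rw [cubicMat_mul]
    have hQ : (1 - a * t ^ 3) * (2 * t) + -(2 * t) * (1 + a * t ^ 3) + a * (2 * t ^ 2 * (2 * t ^ 2)) = 0 := by ring
    have hR : (1 - a * t ^ 3) * (2 * t ^ 2) + -(2 * t) * (2 * t) + 2 * t ^ 2 * (1 + a * t ^ 3) = 0 := by ring
    have hP : (1 - a * t ^ 3) * (1 + a * t ^ 3) + a * (-(2 * t) * (2 * t ^ 2) + 2 * t ^ 2 * (2 * t)) =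
        (1 - a * t ^ 3) * (1 + a * t ^ 3) := by ring
    rw [hQ, hR, hP, one_fin_three]
    ext i j
    fin_cases i <;> fin_cases j <;> simp
  have e4 : (1 + a * t ^ 3)⁻¹ * (1 - a * t ^ 3)⁻¹ * ((1 - a * t ^ 3) * (1 + a * t ^ 3)) = 1 := by
    field_simp
  rw [eσ, e, Matrix.smul_mul, Matrix.mul_smul, smul_smul, e3, smul_smul, e4, one_smul]

end Field

end Literature.NumberTheory.Rogawski1990.TypeThreeTorus
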